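import Literature.Computability.AlgebraicComplexity.Kron444VertexCertificates
import HarnessLib

/-!
# Occurrence certificates for `Kron(4,4,4)`: kernel evaluations, part 2/3

Proofs file (computations only): structural checks and dynamic-programme values of the
certificates cert7, cert8, cert9, cert10, cert11, cert12, cert13, cert14, cert15, cert16, cert17, cert18, cert19, cert20, cert21, cert22, cert23, cert24, cert25, cert26 of `Kron444VertexCertificates.lean`, decided by the kernel
(`decide +kernel`); the evaluator and its soundness are `HighestWeightPairingCertificates.lean`.
[folklore]
-/

set_option Elab.async false

namespace Literature.Computability.AlgebraicComplexity.PairingDP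

/-- The structural checks of `cert7` pass. [folklore] -/
theorem cert7_check : cert7.check = true := by decide +kernel

/-- The dynamic programme of `cert7` evaluates to `2048` (`2638` transitions). [folklore] -/
theorem cert7_value : cert7.dpValue = 2048 := by
  set_option maxHeartbeats 0 in decide +kernel

/-- The structural checks of `cert8` pass. [folklore] -/
theorem cert8_check : cert8.check = true := by decide +kernel

/-- The dynamic programme of `cert8` evaluates to `2048` (`296` transitions). [folklore] -/
theorem cert8_value : cert8.dpValue = 2048 := by
  set_option maxHeartbeats 0 in decide +kernel

/-- The structural checks of `cert9` pass. [folklore] -/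
theorem cert9_check : cert9.check = true := by decide +kernel

/-- The dynamic programme of `cert9` evaluates to `-2304` (`322` transitions). [folklore] -/
theorem cert9_value : cert9.dpValue = -2304 := by
  set_option maxHeartbeats 0 in decide +kernel

/-- The structural checks of `cert10` pass. [folklore] -/
theorem cert10_check : cert10.check = true := by decide +kernel

/-- The dynamic programme of `cert10` evaluates to `3456` (`61` transitions). [folklore] -/
theorem cert10_value : cert10.dpValue = 3456 := by
  set_option maxHeartbeats 0 in decide +kernel

/-- The structural checks of `cert11` pass. [folklore] -/
theorem cert11_check : cert11.check = true := by decide +kernel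

/-- The dynamic programme of `cert11` evaluates to `32` (`78` transitions). [folklore] -/
theorem cert11_value : cert11.dpValue = 32 := by
  set_option maxHeartbeats 0 in decide +kernel

/-- The structural checks of `cert12` pass. [folklore] -/
theorem cert12_check : cert12.check = true := by decide +kernel

/-- The dynamic programme of `cert12` evaluates to `768` (`1072` transitions). [folklore] -/
theorem cert12_value : cert12.dpValue = 768 := by
  set_option maxHeartbeats 0 in decide +kernel

/-- The structural checks of `cert13` pass. [folklore] -/
theorem cert13_check : cert13.check = true := by decide +kernel

/-- The dynamic programme of `cert13` evaluates to `-196608` (`290` transitions). [folklore] -/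
theorem cert13_value : cert13.dpValue = -196608 := by
  set_option maxHeartbeats 0 in decide +kernel

/-- The structural checks of `cert14` pass. [folklore] -/
theorem cert14_check : cert14.check = true := by decide +kernel

/-- The dynamic programme of `cert14` evaluates to `-576` (`754` transitions). [folklore] -/
theorem cert14_value : cert14.dpValue = -576 := by
  set_option maxHeartbeats 0 in decide +kernel

/-- The structural checks of `cert15` pass. [folklore] -/
theorem cert15_check : cert15.check = true := by decide +kernel

/-- The dynamic programme of `cert15` evaluates to `-24` (`62` transitions). [folklore] -/
theorem cert15_value : cert15.dpValue = -24 := by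
  set_option maxHeartbeats 0 in decide +kernel

/-- The structural checks of `cert16` pass. [folklore] -/
theorem cert16_check : cert16.check = true := by decide +kernel

/-- The dynamic programme of `cert16` evaluates to `-720` (`38` transitions). [folklore] -/
theorem cert16_value : cert16.dpValue = -720 := by
  set_option maxHeartbeats 0 in decide +kernel

/-- The structural checks of `cert17` pass. [folklore] -/
theorem cert17_check : cert17.check = true := by decide +kernel

/-- The dynamic programme of `cert17` evaluates to `-1152` (`126` transitions). [folklore] -/
theorem cert17_value : cert17.dpValue = -1152 := by
  set_option maxHeartbeats 0 in decide +kernel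

/-- The structural checks of `cert18` pass. [folklore] -/
theorem cert18_check : cert18.check = true := by decide +kernel

/-- The dynamic programme of `cert18` evaluates to `16` (`17` transitions). [folklore] -/
theorem cert18_value : cert18.dpValue = 16 := by
  set_option maxHeartbeats 0 in decide +kernel

/-- The structural checks of `cert19` pass. [folklore] -/
theorem cert19_check : cert19.check = true := by decide +kernel

/-- The dynamic programme of `cert19` evaluates to `72` (`136` transitions). [folklore] -/
theorem cert19_value : cert19.dpValue = 72 := by
  set_option maxHeartbeats 0 in decide +kernel

/-- The structural checks of `cert20` pass. [folklore] -/
theorem cert20_check : cert20.check = true := by decide +kernel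

/-- The dynamic programme of `cert20` evaluates to `12` (`24` transitions). [folklore] -/
theorem cert20_value : cert20.dpValue = 12 := by
  set_option maxHeartbeats 0 in decide +kernel

/-- The structural checks of `cert21` pass. [folklore] -/
theorem cert21_check : cert21.check = true := by decide +kernel

/-- The dynamic programme of `cert21` evaluates to `9` (`30` transitions). [folklore] -/
theorem cert21_value : cert21.dpValue = 9 := by
  set_option maxHeartbeats 0 in decide +kernel

/-- The structural checks of `cert22` pass. [folklore] -/
theorem cert22_check : cert22.check = true := by decide +kernel

/-- The dynamic programme of `cert22` evaluates to `-32768` (`411` transitions). [folklore] -/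
theorem cert22_value : cert22.dpValue = -32768 := by
  set_option maxHeartbeats 0 in decide +kernel

/-- The structural checks of `cert23` pass. [folklore] -/
theorem cert23_check : cert23.check = true := by decide +kernel

/-- The dynamic programme of `cert23` evaluates to `256` (`77` transitions). [folklore] -/
theorem cert23_value : cert23.dpValue = 256 := by
  set_option maxHeartbeats 0 in decide +kernel

/-- The structural checks of `cert24` pass. [folklore] -/
theorem cert24_check : cert24.check = true := by decide +kernel

/-- The dynamic programme of `cert24` evaluates to `288` (`662` transitions). [folklore] -/
theorem cert24_value : cert24.dpValue = 288 := by
  set_option maxHeartbeats 0 in decide +kernel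

/-- The structural checks of `cert25` pass. [folklore] -/
theorem cert25_check : cert25.check = true := by decide +kernel

/-- The dynamic programme of `cert25` evaluates to `972` (`87` transitions). [folklore] -/
theorem cert25_value : cert25.dpValue = 972 := by
  set_option maxHeartbeats 0 in decide +kernel

/-- The structural checks of `cert26` pass. [folklore] -/
theorem cert26_check : cert26.check = true := by decide +kernel

/-- The dynamic programme of `cert26` evaluates to `-270` (`36` transitions). [folklore] -/
theorem cert26_value : cert26.dpValue = -270 := by
  set_option maxHeartbeats 0 in decide +kernel

end Literature.Computability.AlgebraicComplexity.PairingDP
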